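import Literature.Algebra.Homology.GroupCohomologySemilinear
import Mathlib.Order.Directed
import HarnessLib

/-!
# Cohomology of a finite group commutes with directed unions of coefficient modules:
# `Hⁿ(G, ⋃ₛ Aₛ) = lim→ₛ Hⁿ(G, Aₛ)` (Brown VIII (4.6)/(4.8): `Ext_R^*(M, –)` commutes with direct
# limits for `M` of type `FP_∞`; `ℤ` is of type `FP_∞` over `ℤG` for `G` finite)

Topic `Algebra/Homology`; namespace `Literature.Algebra.Homology.GroupCohomologyDirectedUnion`.
Mathlib plus the tree's degree-uniform glue for `groupCohomology.π` (`GroupCohomologySemilinear`).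
For a FINITE group `G` and a representation `A` PRESENTED AS A DIRECTED UNION — a family `B s`
(`s : S`, a directed preorder) with injective morphisms `ι s : B s ⟶ A` covering `A`, and transition
morphisms `incl h : B s ⟶ B t` (`h : s ≤ t`) over `A` — the two halves of
"`Hⁿ(G, A)` is the direct limit of the `Hⁿ(G, B s)`", stated elementwise (no colimit object is built):

* `exists_map_eq` — every class of `Hⁿ(G, A)` is the image of a class of some `Hⁿ(G, B s)`;
* `exists_map_incl_eq_zero` — a class of `Hⁿ(G, B s)` that dies in `Hⁿ(G, A)` already dies in some
  `Hⁿ(G, B t)`, `t ≥ s`;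

both because an inhomogeneous cochain `Gⁿ → A` of a finite group takes finitely many values, hence
factors through some `B s` (`exists_cochain_lift`).  Consequences: `map_injective_of_forall`
(if all transition maps are injective in degree `n` then so are the `Hⁿ(G, ι s)`), and the vanishing
transfer `isZero_of_forall` (`Hⁿ(G, B s) = 0 ∀ s ⇒ Hⁿ(G, A) = 0`).  Written for the idèle group
`J_E = ⋃_S J_{E,S}` of class field theory (Tate, Cassels–Fröhlich VII §7.3: "`J_L = lim→_S J_{L,S}` … The cohomology
of finite groups commutes with direct limits", i.e. `H^q(G, J) = lim→ H^q(G, J_S)` (our paraphrase); Harari §13.1, proof of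
Prop. 13.1 (b), `Ĥ^i(G, I_K) = lim→_S Ĥ^i(G, ∏_{v∈S} I_K(v) × ∏_{v∉S} U_K(v))`).

## References
* K. S. Brown, *Cohomology of Groups*, GTM 87 (1982), VIII §4, Prop. (4.6) and Thm. (4.8) (with III §1).
  [Brown1982CohomologyGroups]
* J. W. S. Cassels, A. Fröhlich (eds.), *Algebraic Number Theory* (1967), Ch. VII (Tate) §7.3.
  [CasselsFrohlichANT1967]
-/

-- CITATION-FIX (2026-08-27, door-c5 g15; referee N-g52-4; held copy
-- `book:harari2017-galois-cohomology-class-field-theory` [p0204]): an earlier revision cited "Harari Cor. 13.2" for the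
-- limit identity — Cor. 13.2 is `H¹(G, I_K) = H³(G, I_K) = 0`; the identity `Ĥ^i(G, I_K) = lim→_S (…)` is the display in
-- the PROOF of Prop. 13.1 (b).  Declarations unchanged.

noncomputable section

open CategoryTheory CategoryTheory.Limits groupCohomology

universe w u

namespace Literature.Algebra.Homology

namespace GroupCohomologyDirectedUnion

variable {k G : Type u} [CommRing k] [Group G]

/-! ## §1. Cochain glue for one injective morphism -/

section OneMorphism

variable {A B : Rep k G} (φ : B ⟶ A)

/-- The cocycle map has underlying cochain `φ ∘ z`. [cite: Brown1982CohomologyGroups, VIII §4 Prop. (4.6)] -/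
theorem iCocycles_cocyclesMap (n : ℕ) (z : cocycles B n) :
    iCocycles A n (cocyclesMap (MonoidHom.id G) φ n z) =
      ((cochainsMap (MonoidHom.id G) φ).f n).hom (iCocycles B n z) := by
  have h := LinearMap.congr_fun (congrArg ModuleCat.Hom.hom
    (HomologicalComplex.cyclesMap_i (cochainsMap (MonoidHom.id G) φ) n)) z
  simp only [ModuleCat.hom_comp, LinearMap.comp_apply] at h
  exact h

/-- Unfolding: the cochain map of `φ` in degree `m` is postcomposition `x ↦ φ ∘ x`.
[cite: Brown1982CohomologyGroups, VIII §4 Prop. (4.6)] -/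
theorem cochainsMap_f_apply (m : ℕ) (x : (inhomogeneousCochains B).X m) (g : Fin m → G) :
    ((cochainsMap (MonoidHom.id G) φ).f m).hom x g = φ.hom (x g) := rfl

/-- The cochain map commutes with the differentials (elementwise `HomologicalComplex.Hom.comm`).
[cite: Brown1982CohomologyGroups, VIII §4 Prop. (4.6)] -/
theorem cochainsMap_f_d (m m' : ℕ) (x : (inhomogeneousCochains B).X m) :
    ((cochainsMap (MonoidHom.id G) φ).f m').hom ((inhomogeneousCochains B).d m m' x) =
      (inhomogeneousCochains A).d m m' (((cochainsMap (MonoidHom.id G) φ).f m).hom x) := by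
  have h := (cochainsMap (MonoidHom.id G) φ).comm m m'
  have h' := LinearMap.congr_fun (congrArg ModuleCat.Hom.hom h) x
  simp only [ModuleCat.hom_comp, LinearMap.comp_apply] at h'
  exact h'.symm

variable {φ} in
/-- An injective morphism of coefficients induces injective cochain maps.
[cite: Brown1982CohomologyGroups, VIII §4 Prop. (4.6)] -/
theorem cochainsMap_f_injective (hφ : Function.Injective φ.hom) (m : ℕ) :
    Function.Injective ((cochainsMap (MonoidHom.id G) φ).f m).hom := fun _ _ hxy =>
  funext fun g => hφ (congrFun hxy g : _)

variable {φ} in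
/-- **Lifting a cochain along an injective morphism**: a cochain of `A` with values in the image of
`φ` is `φ ∘ x'` for a unique cochain `x'` of `B`. [cite: Brown1982CohomologyGroups, VIII §4 Prop. (4.6)] -/
theorem exists_cochain_eq_of_range (m : ℕ) (x : (inhomogeneousCochains A).X m)
    (hx : ∀ g : Fin m → G, x g ∈ Set.range φ.hom) :
    ∃ x' : (inhomogeneousCochains B).X m, ((cochainsMap (MonoidHom.id G) φ).f m).hom x' = x := by
  choose y hy using hx
  exact ⟨fun g => y g, funext fun g => by rw [cochainsMap_f_apply]; exact hy g⟩

end OneMorphism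

/-! ## §2. Directed systems of coefficients covering `A` -/

section Directed

variable {S : Type w} [Preorder S] [IsDirected S (· ≤ ·)] {A : Rep k G} (B : S → Rep k G)
  (ι : ∀ s, B s ⟶ A) (incl : ∀ ⦃s t : S⦄, s ≤ t → (B s ⟶ B t))
  (hincl : ∀ ⦃s t : S⦄ (h : s ≤ t), incl h ≫ ι t = ι s)
  (hι : ∀ s, Function.Injective (ι s).hom) (hcov : ∀ a : A, ∃ s, a ∈ Set.range (ι s).hom)

omit [IsDirected S (· ≤ ·)] in
include hincl in
/-- The images grow along the system. [cite: Brown1982CohomologyGroups, VIII §4 Prop. (4.6)] -/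
theorem range_subset_of_le {s t : S} (h : s ≤ t) : Set.range (ι s).hom ⊆ Set.range (ι t).hom := by
  rintro _ ⟨b, rfl⟩
  refine ⟨(incl h).hom b, ?_⟩
  exact congrArg (fun f : B s ⟶ A => f.hom b) (hincl h)

include hincl hcov in
/-- **A cochain of a finite group factors through some member of a covering directed system** (it has
finitely many values), and the member can be taken above any given `s₀`.
[cite: Brown1982CohomologyGroups, VIII §4 Prop. (4.6) and Thm. (4.8)] -/
theorem exists_cochain_lift [Finite G] (s₀ : S) (m : ℕ) (x : (inhomogeneousCochains A).X m) :
    ∃ t, s₀ ≤ t ∧ ∃ x' : (inhomogeneousCochains (B t)).X m,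
      ((cochainsMap (MonoidHom.id G) (ι t)).f m).hom x' = x := by
  classical
  haveI : Fintype (Fin m → G) := Fintype.ofFinite _
  haveI : Nonempty S := ⟨s₀⟩
  choose sOf hsOf using hcov
  obtain ⟨t, ht⟩ := Finset.exists_le (insert s₀ (Finset.univ.image fun g : Fin m → G => sOf (x g)))
  refine ⟨t, ht _ (Finset.mem_insert_self _ _), ?_⟩
  apply exists_cochain_eq_of_range
  intro g
  exact range_subset_of_le B ι incl hincl
    (ht _ (Finset.mem_insert_of_mem (Finset.mem_image_of_mem _ (Finset.mem_univ g)))) (hsOf (x g))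

include hincl hι hcov in
/-- **Every class of `Hⁿ(G, A)` comes from some `Hⁿ(G, B s)`** (`G` finite, `A = ⋃ₛ B s` directed).
[cite: Brown1982CohomologyGroups, VIII §4 Prop. (4.6) and Thm. (4.8)][cite: CasselsFrohlichANT1967, Ch. VII §7.3] -/
theorem exists_map_eq [Finite G] (s₀ : S) (n : ℕ) (c : groupCohomology A n) :
    ∃ t, s₀ ≤ t ∧ ∃ c' : groupCohomology (B t) n, groupCohomology.map (MonoidHom.id G) (ι t) n c' = c := by
  obtain ⟨z, rfl⟩ := π_surjective A n c
  obtain ⟨t, ht, x', hx'⟩ := exists_cochain_lift B ι incl hincl hcov s₀ n (iCocycles A n z)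
  have hdx' : inhomogeneousCochains.d (B t) n x' = 0 := by
    have h1 : (inhomogeneousCochains (B t)).d n (n + 1) x' = 0 := by
      apply cochainsMap_f_injective (hι t) (n + 1)
      rw [cochainsMap_f_d, hx', map_zero]
      have := d_iCocycles A n z
      rwa [← inhomogeneousCochains.d_def] at this
    rwa [inhomogeneousCochains.d_def] at h1
  refine ⟨t, ht, groupCohomology.π (B t) n (cocyclesMk x' hdx'), ?_⟩
  rw [groupCohomology.π_map_apply]
  congr 1
  apply iCocycles_injective A n
  rw [iCocycles_cocyclesMap, iCocycles_mk, hx']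

include hincl hι hcov in
/-- **A class of `Hⁿ(G, B s)` that dies in `Hⁿ(G, A)` dies in some `Hⁿ(G, B t)`, `t ≥ s`** (`G` finite).
[cite: Brown1982CohomologyGroups, VIII §4 Prop. (4.6) and Thm. (4.8)][cite: CasselsFrohlichANT1967, Ch. VII §7.3] -/
theorem exists_map_incl_eq_zero [Finite G] (s : S) (n : ℕ) (c' : groupCohomology (B s) n)
    (hc' : groupCohomology.map (MonoidHom.id G) (ι s) n c' = 0) :
    ∃ t, ∃ h : s ≤ t, groupCohomology.map (MonoidHom.id G) (incl h) n c' = 0 := by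
  obtain ⟨z, rfl⟩ := π_surjective (B s) n c'
  rw [groupCohomology.π_map_apply] at hc'
  obtain ⟨w, hw⟩ := (π_apply_eq_zero_iff A n _).1 hc'
  have hdw : (inhomogeneousCochains A).d (n - 1) n w =
      ((cochainsMap (MonoidHom.id G) (ι s)).f n).hom (iCocycles (B s) n z) := by
    rw [← iCocycles_toCocycles, hw, iCocycles_cocyclesMap]
  obtain ⟨t, ht, w', hw'⟩ := exists_cochain_lift B ι incl hincl hcov s (n - 1) w
  refine ⟨t, ht, ?_⟩
  rw [groupCohomology.π_map_apply]
  have hz : cocyclesMap (MonoidHom.id G) (incl ht) n z = toCocycles (B t) (n - 1) n w' := by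
    apply iCocycles_injective (B t) n
    apply cochainsMap_f_injective (hι t) n
    rw [iCocycles_cocyclesMap, iCocycles_toCocycles, cochainsMap_f_d, hw', hdw]
    funext g
    change (ι t).hom ((incl ht).hom (iCocycles (B s) n z g)) = (ι s).hom (iCocycles (B s) n z g)
    exact congrArg (fun f : B s ⟶ A => f.hom (iCocycles (B s) n z g)) (hincl ht)
  rw [hz]
  exact π_toCocycles (B t) (n - 1) n w'

include hincl hι hcov in
/-- If every transition map is injective on `Hⁿ`, so is every `Hⁿ(G, ι s) : Hⁿ(G, B s) → Hⁿ(G, A)`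
(`G` finite). [cite: Brown1982CohomologyGroups, VIII §4 Prop. (4.6) and Thm. (4.8)] -/
theorem map_injective_of_forall [Finite G] (n : ℕ)
    (hinj : ∀ ⦃s t : S⦄ (h : s ≤ t), Function.Injective (groupCohomology.map (MonoidHom.id G) (incl h) n))
    (s : S) : Function.Injective (groupCohomology.map (MonoidHom.id G) (ι s) n) := by
  rw [injective_iff_map_eq_zero]
  intro c' hc'
  obtain ⟨t, ht, h0⟩ := exists_map_incl_eq_zero B ι incl hincl hι hcov s n c' hc'
  exact (injective_iff_map_eq_zero _).1 (hinj ht) c' h0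

include hincl hι hcov in
/-- **Vanishing transfer: `Hⁿ(G, B s) = 0` for all `s` ⇒ `Hⁿ(G, A) = 0`** (`G` finite, `A = ⋃ₛ B s`).
[cite: Brown1982CohomologyGroups, VIII §4 Prop. (4.6) and Thm. (4.8)][cite: CasselsFrohlichANT1967, Ch. VII §7.3] -/
theorem isZero_of_forall [Finite G] [Nonempty S] (n : ℕ) (h : ∀ s, IsZero (groupCohomology (B s) n)) :
    IsZero (groupCohomology A n) := by
  rw [ModuleCat.isZero_iff_subsingleton]
  refine ⟨fun a b => ?_⟩
  obtain ⟨s₀⟩ := (inferInstance : Nonempty S)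
  obtain ⟨t, -, a', rfl⟩ := exists_map_eq B ι incl hincl hι hcov s₀ n a
  obtain ⟨t', -, b', rfl⟩ := exists_map_eq B ι incl hincl hι hcov s₀ n b
  haveI := ModuleCat.subsingleton_of_isZero (h t)
  haveI := ModuleCat.subsingleton_of_isZero (h t')
  rw [Subsingleton.elim a' 0, Subsingleton.elim b' 0, map_zero, map_zero]

end Directed

end GroupCohomologyDirectedUnion

end Literature.Algebra.Homology

end
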